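import Summits.BirchSwinnertonDyer.BirchSwinnertonDyer.Theorems.SylvesterTwoHeegnerIndexYinToricNoTwoTorsion
import Summits.BirchSwinnertonDyer.BirchSwinnertonDyer.Theorems.SylvesterTwoHeegnerIndexYinToricDefs
import Mathlib.FieldTheory.KummerExtension
import HarnessLib

/-!
# Route `SylvesterTwoHeegnerIndex` (rung K7t): the FIELD LAYER of the toric binder (T) made kernel —
# `L = K(i)` exists (Galois, `Gal(L/K) = {1, c}`, `c i = −i`, `[L : ℚ] = 4`, hence `B(L)[2] = 0`), and
# `YinToricDecomposition` from the CM core handed over for every such `L`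

HONEST FRAMING (cell b2b-bsdres, seat x1b GEN 53 = O12 class lead; file `--supports
stmt-BirchSwinnertonDyer-19802 --as helper`; C′ and THEOREM C stay OPEN; nothing here is a mechanism, a
definition or a named fact). bsd-cm-two g9's binder `YinToricDecomposition` (p503032; stub (T) of the skeletons of
record S-19802/toric and VARIANT G, planner D148) asks, per `(p, B, K ∋ ω, P)`, for a display point `Y` AND
«a Galois extension `L/K` with `Gal(L/K) = {1, c}` (source: `L = K(i)`), in which `B` has no point of order `2`,
an additive `θ`, an odd `N` and `R, T ∈ B(L)` with `TraceRelationAtTwo` and `AntiTraceIsTorsion`». The FIELD part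
of this is kernel:

* §1 `sq_ne_neg_one_of_finrank_two` — `−1` is not a square in a quadratic number field containing `ω`
  (else `s := √−1·(2ω + 1)` has `s² = 3`, `s ∉ ℚ`, `{1, s}` is a `ℚ`-basis, and `(2ω+1)² = −3` reads
  `u² + 3v² + 3 = 0` in `ℚ`);
* §2 **`exists_quadraticExtension_sqrt_neg_one`** — for such `K` there is `L ⊇ K` (a splitting field of `X² + 1`,
  i.e. `L = K(i)`): a number field, Galois over `K` with `Gal(L/K) = {1, c}`, `i ∈ L`, `i² = −1`, `c i = −i`,
  `[L : ℚ] = 4` (Mathlib's Kummer theory `autEquivZmod` at `n = 2`; x1b [158] did `n = 3`); with x1b [164]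
  `eq_zero_of_two_nsmul_eq_zero_of_finrank_eq_four` this `L` also satisfies «`B(L)[2] = 0`» for every model
  `B ≅ E_p`, `p` odd;
* §3 **`yinToricDecomposition_of_core`** — `YinToricDecomposition` from its CM CORE: the same display point `Y, u`,
  and — for EVERY quadratic Galois `L ∋ i` over `K` with `Gal = {1, c}`, `c i = −i`, HANDED OVER BY THE KERNEL —
  the data `θ, N, R, T` with `N` odd, `T` torsion, `TraceRelationAtTwo`, `AntiTraceIsTorsion`.

So the non-kernel residue of stub (T) is exactly Yin's point with its display (PRE: arXiv:2607.01744 Thm 1.1 /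
(3.5.3) / Thm 2.2) and the CM-point laws over `K(i)` (memo v2.10 §52 Lemmas A–E, referee g43 PASS) — no field
theory. NO definition, NO named fact, NO sorry; axioms standard; closes no item; nothing booked; no label moves.
References: MEMO-bsd-cm-two v2.10 §52.3 (B2)–(B4); `…YinToricDefs` (p503032); pub/bsd-cm STATUS D148, D152.
-/

set_option autoImplicit false
-- the Summit-side namespace `Summit.BirchSwinnertonDyer.BirchSwinnertonDyer.…` (summit = problem) is mandated by D-0017
set_option linter.dupNamespace false

noncomputable section

open scoped Classical

open Polynomial WeierstrassCurve WeierstrassCurve.Affine WeierstrassCurve.Affine.Point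
open Summit.BirchSwinnertonDyer.BirchSwinnertonDyer.Theorems.SylvesterTwoYin
  Summit.BirchSwinnertonDyer.BirchSwinnertonDyer.Theorems.SylvesterTwoYinToric
  Literature.NumberTheory.EllipticCurves Literature.NumberTheory.EllipticCurves.HuShuYin2019

namespace Summit.BirchSwinnertonDyer.BirchSwinnertonDyer.Theorems.SylvesterTwoYinToricDescent

/-! ## §1 `−1` is not a square in a quadratic field containing `ω` -/

section Quadratic

variable {K : Type*} [Field K] [CharZero K]

/-- `3` is not a rational square (`v₃ = 1` is odd). [folklore] -/
theorem ratCast_ne_of_sq_eq_three {s : K} (hs : s ^ 2 = 3) (q : ℚ) : (q : K) ≠ s := by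
  intro hq
  have h3 : q ^ 2 = 3 := by
    have e : ((q ^ 2 : ℚ) : K) = ((3 : ℚ) : K) := by push_cast; rw [hq, hs]
    exact_mod_cast e
  haveI : Fact (Nat.Prime 3) := ⟨Nat.prime_three⟩
  have hv := congrArg (padicValRat 3) h3
  have h33 : padicValRat 3 (3 : ℚ) = 1 := by simpa using padicValRat.self (p := 3) (by norm_num)
  rw [padicValRat.pow, h33] at hv
  omega

/-- **`−1` is not a square in a quadratic number field `K ∋ ω`** (`ω² + ω + 1 = 0`): if `b² = −1` then
`s := b·(2ω + 1)` has `s² = 3`, so `s ∉ ℚ` and `{1, s}` is a `ℚ`-basis of `K`; writing `2ω + 1 = u + v·s` and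
squaring, `(2ω + 1)² = −3` gives `u² + 3v² + 3 = 0` in `ℚ`, absurd. (So `ℚ(ω) ∌ i`: `X² + 1` is irreducible over
`K` and `K(i)/K` is quadratic.) [folklore] -/
theorem sq_ne_neg_one_of_finrank_two [FiniteDimensional ℚ K] (h2K : Module.finrank ℚ K = 2) {ω : K}
    (hω : ω ^ 2 + ω + 1 = 0) (b : K) : b ^ 2 ≠ -1 := by
  intro hb
  obtain ⟨s, hs⟩ : ∃ s : K, s = b * (2 * ω + 1) := ⟨_, rfl⟩
  have hs2 : s ^ 2 = 3 := by
    rw [hs, mul_pow, hb]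
    linear_combination (-4) * hω
  have hsq := ratCast_ne_of_sq_eq_three hs2
  -- `{1, s}` is linearly independent over `ℚ`, hence a basis (`[K : ℚ] = 2`)
  have hli : LinearIndependent ℚ ![(1 : K), s] := by
    refine LinearIndependent.pair_iff.mpr fun u v huv => ?_
    rw [Rat.smul_def, Rat.smul_def, mul_one] at huv
    by_cases hv : v = 0
    · rw [hv, Rat.cast_zero, zero_mul, add_zero] at huv
      exact ⟨by exact_mod_cast huv, hv⟩
    · exfalso
      have hvK : (v : K) ≠ 0 := by exact_mod_cast hv
      apply hsq (-u / v)
      push_cast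
      field_simp
      linear_combination -huv
  have hcard : Fintype.card (Fin 2) = Module.finrank ℚ K := by rw [Fintype.card_fin, h2K]
  let bs := basisOfLinearIndependentOfCardEqFinrank hli hcard
  -- coordinates of `2ω + 1`
  have hrep : (2 * ω + 1 : K) = ((bs.repr (2 * ω + 1) 0 : ℚ) : K) + ((bs.repr (2 * ω + 1) 1 : ℚ) : K) * s := by
    have e := bs.sum_repr (2 * ω + 1)
    rw [Fin.sum_univ_two] at e
    simp only [bs, coe_basisOfLinearIndependentOfCardEqFinrank, Matrix.cons_val_zero, Matrix.cons_val_one,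
      Rat.smul_def, mul_one] at e
    exact e.symm
  set u : ℚ := bs.repr (2 * ω + 1) 0
  set v : ℚ := bs.repr (2 * ω + 1) 1
  have ht2 : (2 * ω + 1 : K) ^ 2 = -3 := by linear_combination 4 * hω
  rw [hrep] at ht2
  -- `(u + v s)² = −3` with `s² = 3`: `(u² + 3v² + 3)·1 + (2uv)·s = 0`
  have key : ((u ^ 2 + 3 * v ^ 2 + 3 : ℚ)) • (1 : K) + ((2 * u * v : ℚ)) • s = 0 := by
    rw [Rat.smul_def, Rat.smul_def, mul_one]
    push_cast
    linear_combination ht2 - ((v : K)) ^ 2 * hs2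
  have h0 := (LinearIndependent.pair_iff.mp hli _ _ key).1
  have hpos : (0 : ℚ) < u ^ 2 + 3 * v ^ 2 + 3 := by positivity
  exact absurd h0 hpos.ne'

end Quadratic

/-! ## §2 The quadratic extension `L = K(i)`: Galois, `Gal = {1, c}`, `c i = −i`, `[L : ℚ] = 4` -/

/-- **THE FIELD `L = K(i)` EXISTS with the binder's properties.** For a quadratic number field `K ∋ ω` there is
a number field `L ⊇ K` — a splitting field of `X² + 1` over `K` — Galois over `K` with `Gal(L/K) = {1, c}`, an
element `i ∈ L` with `i² = −1` and `c i = −i`, and `[L : ℚ] = 4` (Mathlib Kummer theory at `n = 2`: `−1` is a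
primitive square root of unity in `K`, `X² + 1` is irreducible by §1, `autEquivZmod : Gal(L/K) ≃* ℤ/2`). Memo
(B2)/(B3): `Gal(F″/F′) = ⟨σ⟩`, `σ|_{K(i)} = c`. [folklore] -/
theorem exists_quadraticExtension_sqrt_neg_one (K : Type) [Field K] [NumberField K]
    (h2K : Module.finrank ℚ K = 2) {ω : K} (hω : ω ^ 2 + ω + 1 = 0) :
    ∃ (L : Type) (_ : Field L) (_ : NumberField L) (_ : Algebra K L) (_ : IsGalois K L)
      (c : L ≃ₐ[K] L) (i : L), (∀ σ : L ≃ₐ[K] L, σ = AlgEquiv.refl ∨ σ = c) ∧ i ^ 2 = -1 ∧ c i = -i ∧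
      Module.finrank ℚ L = 4 := by
  have ha : ∀ b : K, b ^ 2 ≠ (-1 : K) := sq_ne_neg_one_of_finrank_two h2K hω
  have H : Irreducible (X ^ 2 - C (-1 : K)) := X_pow_sub_C_irreducible_of_prime Nat.prime_two ha
  have hneg : IsPrimitiveRoot (-1 : K) 2 := IsPrimitiveRoot.neg_one 0 (by norm_num)
  have hζ : (primitiveRoots 2 K).Nonempty := ⟨-1, (mem_primitiveRoots two_pos).mpr hneg⟩
  let L := (X ^ 2 - C (-1 : K)).SplittingField
  haveI : IsGalois K L := isGalois_of_isSplittingField_X_pow_sub_C hζ H L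
  haveI : FiniteDimensional K L := Polynomial.IsSplittingField.finiteDimensional L (X ^ 2 - C (-1 : K))
  haveI : CharZero L := charZero_of_injective_algebraMap (algebraMap K L).injective
  haveI : FiniteDimensional ℚ L := Module.Finite.trans K L
  have hNF : NumberField L := @NumberField.mk L _ inferInstance inferInstance
  have hi := rootOfSplitsXPowSubC_pow (n := 2) (-1 : K) L
  set i : L := rootOfSplitsXPowSubC (NeZero.pos 2) (-1 : K) L with hi_def
  set c : L ≃ₐ[K] L := (autEquivZmod H L hneg).symm (Multiplicative.ofAdd 1) with hc_def
  have hgen : ∀ σ : L ≃ₐ[K] L, σ = AlgEquiv.refl ∨ σ = c := by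
    intro τ
    have hτ : τ = (autEquivZmod H L hneg).symm (Multiplicative.ofAdd ((autEquivZmod H L hneg τ).toAdd)) := by
      rw [ofAdd_toAdd, MulEquiv.symm_apply_apply]
    have h01 : ∀ m : ZMod 2, m = 0 ∨ m = 1 := by decide
    rcases h01 ((autEquivZmod H L hneg τ).toAdd) with h | h
    · left
      rw [hτ, h, ofAdd_zero, map_one, AlgEquiv.aut_one]
    · right
      rw [hτ, h]
  have hci : c i = -i := by
    have h := autEquivZmod_symm_apply_natCast H L hi hneg 1
    rw [Nat.cast_one, pow_one, neg_one_smul] at h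
    exact h
  have h4 : Module.finrank ℚ L = 4 := by
    rw [← Module.finrank_mul_finrank ℚ K L, h2K, finrank_of_isSplittingField_X_pow_sub_C hζ H L]
  refine ⟨L, inferInstance, hNF, inferInstance, inferInstance, c, i, hgen, ?_, hci, h4⟩
  rw [hi, map_neg, map_one]

/-! ## §3 `YinToricDecomposition` from its CM core, the field layer supplied by the kernel -/

/-- **THE TORIC BINDER (T) FROM ITS CM CORE.** If for every prime `p ≡ 7 (9)`, every minimal `B ≅ E_p` with
`#Ш_an(B) = qB`, every quadratic `K ∋ ω` with `rank_ℤ B(K) = 2` and every rational generator `P`, one is given a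
display point `Y ∈ B(K)` with a `2`-adic unit `u` (Yin Thm 1.1 / (3.5.3), PRE) AND — for EVERY number field
`L ⊇ K`, Galois with `Gal(L/K) = {1, c}`, with `i ∈ L`, `i² = −1`, `c i = −i`, HANDED OVER BY THE KERNEL (§2) —
an additive `θ` on `B(L)`, an odd `N`, and `R, T ∈ B(L)` with `T` torsion, `TraceRelationAtTwo B K L c θ N Y R T`
and `AntiTraceIsTorsion B K L c R` (memo §52 Lemmas A–E over `K(i)`), THEN `YinToricDecomposition` holds: the
kernel supplies `L = K(i)` (§2) and «`B(L)[2] = 0`» (x1b [164], `[L : ℚ] = 4`). The binder stays a DERIVED claim;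
nothing is closed. [cite-level reading: arXiv:2607.01744 Thm. 1.1, Thm. 2.2; MEMO bsd-cm-two v2.10 §52] -/
theorem yinToricDecomposition_of_core
    (hCore : ∀ (p : ℕ), p.Prime → p % 9 = 7 →
      ∀ (B : WeierstrassCurve ℚ) [B.IsElliptic] [B.IsGloballyMinimal],
      (∃ C : VariableChange ℚ, C • B = cubeSumCurve (p : ℚ)) → ∀ (qB : ℚ), shaAn B = (qB : ℂ) →
      ∀ (K : Type) [Field K] [NumberField K] (ω : K), ω ^ 2 + ω + 1 = 0 → Module.finrank ℚ K = 2 →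
        (B.baseChange K).mordellWeilRank = 2 →
      ∀ (P : B.toAffine.Point), ¬ IsOfFinAddOrder (QuadraticDescent.incl K B P) →
        (∀ Q : B.toAffine.Point, ∃ m : ℤ,
          IsOfFinAddOrder (QuadraticDescent.incl K B Q - m • QuadraticDescent.incl K B P)) →
      ∃ (Y : (B.baseChange K).toAffine.Point) (u : ℚ), u ≠ 0 ∧ padicValRat 2 u = 0 ∧
        ((u * qB : ℚ) : ℝ) * canonicalHeight (QuadraticDescent.incl K B P) =
          (2 : ℝ) ^ (-2 : ℤ) * canonicalHeight Y ∧
        ∀ (L : Type) [Field L] [NumberField L] [Algebra K L] [IsGalois K L] (c : L ≃ₐ[K] L) (i : L),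
          (∀ σ : L ≃ₐ[K] L, σ = AlgEquiv.refl ∨ σ = c) → i ^ 2 = -1 → c i = -i →
          ∃ (θ : (B.baseChange L).toAffine.Point →+ (B.baseChange L).toAffine.Point) (N : ℤ)
            (R T : (B.baseChange L).toAffine.Point),
            Odd N ∧ IsOfFinAddOrder T ∧ TraceRelationAtTwo B K L c θ N Y R T ∧ AntiTraceIsTorsion B K L c R) :
    YinToricDecomposition := by
  intro p hp h7 B _ _ hB qB hqB K _ _ ω hω h2K hrank P hP hgen
  obtain ⟨Y, u, hu0, hu, hdisp, hL⟩ := hCore p hp h7 B hB qB hqB K ω hω h2K hrank P hP hgen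
  obtain ⟨L, _, _, _, _, c, i, hgal, hi, hci, h4⟩ := exists_quadraticExtension_sqrt_neg_one K h2K hω
  obtain ⟨θ, N, R, T, hN, hT, htr, hanti⟩ := hL L c i hgal hi hci
  obtain ⟨C, hC⟩ := hB
  have hp2 : p ≠ 2 := by omega
  exact ⟨Y, u, hu0, hu, hdisp, L, ‹_›, ‹_›, ‹_›, ‹_›, c, θ, N, R, T, hgal,
    fun Q hQ => eq_zero_of_two_nsmul_eq_zero_of_finrank_eq_four h4 hp hp2 B C hC Q hQ, hN, hT, htr, hanti⟩

end Summit.BirchSwinnertonDyer.BirchSwinnertonDyer.Theorems.SylvesterTwoYinToricDescent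

end
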